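import Summits.NavierStokesRegularity.NavierStokesRegularity.Theorems.ExtremiserTransiencePerFlowEnstrophyGronwallSliceRate
import Summits.NavierStokesRegularity.NavierStokesRegularity.Theorems.ExtremiserTransienceAveragedRungSlab
import Summits.NavierStokesRegularity.NavierStokesRegularity.Theorems.TypeICertificateLadderRungReynoldsOneAprioriDecay
import Literature.Analysis.FluidPDE.BKMClassGradientContinuity
import Literature.Analysis.FluidPDE.TaoEnstrophyLocalisationProofs
import HarnessLib

/-!
# Route `ExtremiserTransience`, LINE g4-α «per-flow-tangent» (ns-idea-5 g4): preliminaries for the log-density of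
# LOCKED late times (stub S1 of skeleton v3c)

`--supports stmt-NavierStokesRegularity-26568` (`TangentExtremalExtraction`).  Three elementary facts used by
`PerFlow.lockedTimes_logDensity`: Young's inequality in cap form, interval-integrability of `1_A(τ)/(T−τ)`, and the
`L²` identities at a slice of a Tao slab (`ofReal Z = ∫⁻‖curl‖ₑ²`, `∫⁻|∇u|² = ∫⁻|curl u|²`).
HONEST FRAMING: bookkeeping only; nothing about Navier–Stokes regularity or blow-up is proved. [folklore]
-/

noncomputable section

open Set Filter Topology MeasureTheory
open scoped InnerProductSpace RealInnerProductSpace ENNReal NNReal ContDiff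
open Literature.Analysis.FluidPDE

namespace Summit.NavierStokesRegularity.NavierStokesRegularity.Theorems.DepletionLadder.PerFlow
set_option linter.dupNamespace false
set_option linter.style.longLine false

/-- Young's inequality in the form used for the cap rate: `k·M·z·x − ν·x² ≤ (k²M²/(4ν))·z²`. [folklore] -/
theorem young_cap {ν k M z x : ℝ} (hν : 0 < ν) :
    k * M * z * x - ν * x ^ 2 ≤ k ^ 2 * M ^ 2 / (4 * ν) * z ^ 2 := by
  rw [div_mul_eq_mul_div, le_div_iff₀ (by positivity : (0:ℝ) < 4 * ν)]
  nlinarith [sq_nonneg (2 * ν * x - k * M * z), hν]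

/-- The log-density integral of an indicator: basic facts on `[t₁, t] ⊆ [t₁, T)`. [folklore] -/
theorem intervalIntegrable_indicator_div {T t₁ t : ℝ} {A : Set ℝ} (hA : MeasurableSet A) (h1 : t₁ ≤ t) (ht : t < T) :
    IntervalIntegrable (fun τ => A.indicator (fun _ => (1 : ℝ)) τ / (T - τ)) volume t₁ t := by
  classical
  have hmeasf : Measurable (A.indicator (fun _ => (1 : ℝ))) := measurable_const.indicator hA
  have ind_cases : ∀ τ : ℝ, A.indicator (fun _ => (1 : ℝ)) τ = 0 ∨ A.indicator (fun _ => (1 : ℝ)) τ = 1 := by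
    intro τ
    by_cases hτ : τ ∈ A
    · right; rw [Set.indicator_apply, if_pos hτ]
    · left; rw [Set.indicator_apply, if_neg hτ]
  have h01 : ∀ τ, 0 ≤ A.indicator (fun _ => (1 : ℝ)) τ ∧ A.indicator (fun _ => (1 : ℝ)) τ ≤ 1 := fun τ => by
    rcases ind_cases τ with h | h <;> rw [h] <;> norm_num
  have h' := Summit.NavierStokesRegularity.NavierStokesRegularity.Theorems.DepletionLadder.intervalIntegrable_coeff_sq_div
    (T := T) hmeasf h01 h1 ht
  have hsq : (fun τ => A.indicator (fun _ => (1 : ℝ)) τ ^ 2 / (T - τ)) = fun τ => A.indicator (fun _ => (1 : ℝ)) τ / (T - τ) := by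
    funext τ; rcases ind_cases τ with h | h <;> simp [h]
  rw [← hsq]; exact h'

/-- `L²` facts at a slice of a Tao slab: the real enstrophy is the extended one, and `∫⁻|∇u|² = ∫⁻|curl u|²`.
[folklore] -/
theorem slab_slice_facts {ν T' : ℝ}
    {u : ℝ → EuclideanSpace ℝ (Fin 3) → EuclideanSpace ℝ (Fin 3)} {q : ℝ → EuclideanSpace ℝ (Fin 3) → ℝ}
    (hsolq : IsClassicalNSSolutionOn (Icc 0 T') ν 0 u q) (hBq : HasBoundedSobolevNormsOn (Icc 0 T') u)
    (τ : ℝ) (hτ : τ ∈ Icc 0 T') :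
    ENNReal.ofReal (∫ x, ‖curl (u τ) x‖ ^ 2) = ∫⁻ x, ‖curl (u τ) x‖ₑ ^ 2 ∧
      ∫⁻ x, ENNReal.ofReal (frobeniusNormSq (fderiv ℝ (u τ) x)) = ∫⁻ x, ‖curl (u τ) x‖ₑ ^ 2 := by
  have e0 : ∀ (f : EuclideanSpace ℝ (Fin 3) → EuclideanSpace ℝ (Fin 3)),
      ∫⁻ x, ‖f x‖ₑ ^ 2 = ∫⁻ x, ‖iteratedFDeriv ℝ 0 f x‖ₑ ^ 2 :=
    fun f => lintegral_congr fun x => by rw [← ofReal_norm, ← ofReal_norm, norm_iteratedFDeriv_zero]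
  obtain ⟨C₀, hC₀⟩ := hBq 0
  obtain ⟨C₁, hC₁⟩ := hBq 1
  obtain ⟨C₂, hC₂⟩ := hBq 2
  have hv : ContDiff ℝ ∞ (u τ) := hsolq.contDiff_velocity hτ
  have hv2 : ContDiff ℝ 2 (u τ) := hv.of_le (by norm_cast)
  have h0 : ∫⁻ x, ‖u τ x‖ₑ ^ 2 < ⊤ := by
    rw [e0]; exact (hC₀ τ hτ).trans_lt ENNReal.coe_lt_top
  have h1 : ∫⁻ x, ‖iteratedFDeriv ℝ 1 (u τ) x‖ₑ ^ 2 < ⊤ := (hC₁ τ hτ).trans_lt ENNReal.coe_lt_top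
  have h2 : ∫⁻ x, ‖iteratedFDeriv ℝ 2 (u τ) x‖ₑ ^ 2 < ⊤ := (hC₂ τ hτ).trans_lt ENNReal.coe_lt_top
  have hcurl_lt : ∫⁻ x, ‖curl (u τ) x‖ₑ ^ 2 < ⊤ := by
    calc ∫⁻ x, ‖curl (u τ) x‖ₑ ^ 2 ≤ ∫⁻ x, 6 * ‖iteratedFDeriv ℝ 1 (u τ) x‖ₑ ^ 2 :=
          lintegral_mono fun x => RungReynoldsOne.enorm_curl_sq_le_six_mul (u τ) x
      _ = 6 * ∫⁻ x, ‖iteratedFDeriv ℝ 1 (u τ) x‖ₑ ^ 2 := lintegral_const_mul' _ _ (by norm_num)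
      _ < ⊤ := ENNReal.mul_lt_top (by norm_num) h1
  have hcc : Continuous (curl (u τ)) := (contDiff_curl (n := 1) hv2).continuous
  have isq : Integrable (fun x => ‖curl (u τ) x‖ ^ 2) volume :=
    integrable_sq_norm_of_lintegral_lt_top hcc hcurl_lt
  exact ⟨ofReal_integral_sq_norm isq,
    lintegral_frobeniusNormSq_fderiv_eq_lintegral_curl_sq hv2 (hsolq.divFree τ hτ) h0 h1 h2⟩

end Summit.NavierStokesRegularity.NavierStokesRegularity.Theorems.DepletionLadder.PerFlow

end
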